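import Summits.AtomisticToContinuum.Crystallization.Theorems.ThreeConeCertificateKeplerBoundLocLimCrys

/-!
# Route `BrittleRungDescent`, item `MieRung` (stmt-AtomisticToContinuum-10946): the energetic
# conjunct for a general Lennard-Jones-like pair potential, IV — ground states: the removal
# inequality, and local limits from the Blanc–Lewin form

Part IV of the generic-`V` series (hypotheses as in part I, `BrittleRungDescentMieRungPeriodic`;
this part is independent of parts I–III).  Two inputs about GROUND STATES of a general pair
potential `V` on `ℝ³`:

* **Removal inequality** (`sum_siteEnergy_sub_le_groundStateEnergy`; needs `V 0 = 0`, `V ≤ 0` on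
  `[1, ∞)`, stability, ground states of every size).  In a ground state `x` of `N` particles,
  for every set `S` of `n` particles, `Σ_{i ∈ S} 𝓔ⁱ(x) − ½ Σ_{i,k ∈ S} V(|x i − x k|) ≤ E_V(n)`:
  replace the particles of `S` by a far-away translate of an `n`-particle ground state (all
  cross distances `> 1`, where `V ≤ 0`), keep the others, and compare with `E_V(N) = 𝓔_V(x)`.
  Generic-`V` version of `KeplerBoundLocalLimit.sum_siteEnergy_sub_le_groundStateEnergy`.
* **Local limits from the Blanc–Lewin form** (`exists_isLocalLimit_of_isCrystallizing`; needs
  ground states of every size with a uniform minimal distance `δ > 0`).  If `IsCrystallizing V 3`,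
  the periodic configuration carrying the vague limit of (a translated subsequence of) a
  ground-state sequence is a local limit of translated ground states in the sense of two-way
  matching on balls (`IsLocalLimitOfGroundStates V 3 P.points`): the minimal distance forces
  multiplicity `1`, cone bumps at the finitely many sites in a ball give particles near every
  site, and a plateau test function counts the particles in the ball.  Generic-`V` version of
  `KeplerBoundLocalLimit.exists_isLocalLimit_of_isCrystallizing` (whose cone-bump lemmas and
  far placement `exists_far_shift` are reused).

All `[folklore]` (Blanc–Lewin 2015, §1.2 and §2.2).
-/

noncomputable section

open scoped BigOperators Topology
open Filter Set Metric

namespace Summit.AtomisticToContinuum.Crystallization.Theorems.MieRungEnergetic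

open Literature.MathematicalPhysics.StatisticalMechanics
open Summit.AtomisticToContinuum.Crystallization.Theorems.SlackRigidityNegative (E3)
open Summit.AtomisticToContinuum.Crystallization.Theorems.KeplerBoundLocalLimit
  (exists_far_shift coneBump_le coneBump_sub_dist_le_coneBump)

variable {V : ℝ → ℝ} {C : ℝ}

/-- The site energy is the full row sum when `V 0 = 0`. [folklore] -/
theorem siteEnergy_eq_sum (hV0 : V 0 = 0) {N : ℕ} (x : Fin N → E3) (i : Fin N) :
    siteEnergy V x i = ∑ k, V (dist (x i) (x k)) := by
  unfold siteEnergy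
  rw [← Finset.add_sum_erase Finset.univ _ (Finset.mem_univ i), dist_self, hV0, zero_add]

/-- **The multi-particle removal inequality.** In a ground state `x` of `N` particles in `ℝ³`
of a stable potential `V` with `V 0 = 0`, `V ≤ 0` on `[1, ∞)` and ground states of every size,
for every set `S` of particles,
`Σ_{i ∈ S} 𝓔ⁱ(x) − ½ Σ_{i ∈ S} Σ_{k ∈ S} V(|x i − x k|) ≤ E_V(#S)`.
(Replace the particles of `S` by a far translate of a ground state of `#S` particles.)
[folklore] -/
theorem sum_siteEnergy_sub_le_groundStateEnergy (hV0 : V 0 = 0)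
    (hfar : ∀ r, 1 ≤ r → V r ≤ 0)
    (hstab : ∀ (n : ℕ) (y : Fin n → E3), Function.Injective y →
      -(C * n) ≤ interactionEnergy V y)
    (hex : ∀ n : ℕ, ∃ z : Fin n → E3, IsGroundState V z)
    {N : ℕ} {x : Fin N → E3} (hx : IsGroundState V x) (S : Finset (Fin N)) :
    ∑ i ∈ S, siteEnergy V x i -
        1 / 2 * ∑ i ∈ S, ∑ k ∈ S, V (dist (x i) (x k)) ≤
      groundStateEnergy V 3 S.card := by
  classical
  -- an `#S`-particle ground state, translated far away
  obtain ⟨z, hz⟩ := hex S.card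
  obtain ⟨c, hfar'⟩ := exists_far_shift x z
  set e := S.equivFin with he
  set x' : Fin N → E3 := fun k => if h : k ∈ S then z (e ⟨k, h⟩) + c else x k with hx'
  have hx'S : ∀ k (h : k ∈ S), x' k = z (e ⟨k, h⟩) + c := fun k h => by simp [hx', h]
  have hx'c : ∀ k, k ∉ S → x' k = x k := fun k h => by simp [hx', h]
  -- the competitor consists of distinct points
  have hinj : Function.Injective x' := by
    intro k l hkl
    by_cases hk : k ∈ S <;> by_cases hl : l ∈ S
    · rw [hx'S k hk, hx'S l hl] at hkl
      have h1 := hz.1 (add_right_cancel hkl)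
      have h2 := e.injective h1
      exact congrArg Subtype.val h2
    · rw [hx'S k hk, hx'c l hl] at hkl
      have := hfar' l (e ⟨k, hk⟩)
      rw [← hkl, dist_self] at this
      exact absurd this (by norm_num)
    · rw [hx'c k hk, hx'S l hl] at hkl
      have := hfar' k (e ⟨l, hl⟩)
      rw [hkl, dist_self] at this
      exact absurd this (by norm_num)
    · rw [hx'c k hk, hx'c l hl] at hkl
      exact hx.1 hkl
  have hmin : interactionEnergy V x ≤ interactionEnergy V x' := by
    rw [hx.2]
    exact groundStateEnergy_le V ⟨-(C * N), by rintro _ ⟨y, rfl⟩; exact hstab N y.1 y.2⟩ hinj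
  -- double sums
  have h2 := two_mul_interactionEnergy_eq_sum_sum V hV0 x
  have h2' := two_mul_interactionEnergy_eq_sum_sum V hV0 x'
  rw [sum_sum_eq_add_compl _ S] at h2 h2'
  -- (a) outside `S` nothing changes
  have hcc : ∑ i ∈ Sᶜ, ∑ k ∈ Sᶜ, V (dist (x' i) (x' k)) =
      ∑ i ∈ Sᶜ, ∑ k ∈ Sᶜ, V (dist (x i) (x k)) :=
    Finset.sum_congr rfl fun i hi => Finset.sum_congr rfl fun k hk => by
      rw [hx'c i (Finset.mem_compl.1 hi), hx'c k (Finset.mem_compl.1 hk)]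
  -- (b) inside `S` the competitor is the translated ground state `z`
  have hSS : ∑ i ∈ S, ∑ k ∈ S, V (dist (x' i) (x' k)) =
      2 * groundStateEnergy V 3 S.card := by
    have hrow : ∀ i ∈ S, ∑ k ∈ S, V (dist (x' i) (x' k)) =
        ∑ b : Fin S.card, V (dist (x' i) (z b + c)) := by
      intro i _
      rw [← Finset.sum_coe_sort S]
      rw [← e.sum_comp (fun b => V (dist (x' i) (z b + c)))]
      exact Finset.sum_congr rfl fun k _ => by rw [hx'S k.1 k.2]
    rw [Finset.sum_congr rfl hrow, ← Finset.sum_coe_sort S]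
    have h1 : ∀ a : ↥S, ∑ b : Fin S.card, V (dist (x' a) (z b + c)) =
        ∑ b : Fin S.card, V (dist (z (e a) + c) (z b + c)) := fun a => by
      rw [hx'S a.1 a.2]
    rw [Finset.sum_congr rfl fun a _ => h1 a]
    have h3 : ∑ a : ↥S, ∑ b : Fin S.card, V (dist (z (e a) + c) (z b + c)) =
        ∑ a' : Fin S.card, ∑ b : Fin S.card, V (dist (z a' + c) (z b + c)) :=
      e.sum_comp (fun a' => ∑ b : Fin S.card, V (dist (z a' + c) (z b + c)))
    rw [h3, ← hz.2, two_mul_interactionEnergy_eq_sum_sum V hV0 z]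
    exact Finset.sum_congr rfl fun a _ => Finset.sum_congr rfl fun b _ => by
      rw [dist_add_right]
  -- (c) the new cross terms are non-positive
  have hcross1 : ∑ i ∈ S, ∑ k ∈ Sᶜ, V (dist (x' i) (x' k)) ≤ 0 :=
    Finset.sum_nonpos fun i hi => Finset.sum_nonpos fun k hk => by
      rw [hx'S i hi, hx'c k (Finset.mem_compl.1 hk), dist_comm]
      exact hfar _ (hfar' k _).le
  have hcross2 : ∑ i ∈ Sᶜ, ∑ k ∈ S, V (dist (x' i) (x' k)) ≤ 0 :=
    Finset.sum_nonpos fun i hi => Finset.sum_nonpos fun k hk => by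
      rw [hx'c i (Finset.mem_compl.1 hi), hx'S k hk]
      exact hfar _ (hfar' i _).le
  -- (d) for `x`: the two cross blocks coincide, and `Σ_{i ∈ S} 𝓔ⁱ = SS + cross`
  have hsym : ∑ i ∈ Sᶜ, ∑ k ∈ S, V (dist (x i) (x k)) =
      ∑ i ∈ S, ∑ k ∈ Sᶜ, V (dist (x i) (x k)) := by
    rw [Finset.sum_comm]
    exact Finset.sum_congr rfl fun i _ => Finset.sum_congr rfl fun k _ => by rw [dist_comm]
  have hsite : ∑ i ∈ S, siteEnergy V x i =
      ∑ i ∈ S, ∑ k ∈ S, V (dist (x i) (x k)) +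
        ∑ i ∈ S, ∑ k ∈ Sᶜ, V (dist (x i) (x k)) := by
    rw [← Finset.sum_add_distrib]
    refine Finset.sum_congr rfl fun i _ => ?_
    rw [siteEnergy_eq_sum hV0, ← Finset.sum_add_sum_compl S]
  -- assemble
  linarith


/-! ### Local limits from the Blanc–Lewin form of crystallization -/

/-- **The Blanc–Lewin limit of uniformly separated ground states is a local limit in `𝔏`.**
If the ground states of `V` in `ℝ³` exist for every `N` and are uniformly `δ`-separated
(`δ > 0`), and `IsCrystallizing V 3`, then some periodic configuration `P` of `ℝ³` has
`IsLocalLimitOfGroundStates V 3 P.points`. [folklore] -/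
theorem exists_isLocalLimit_of_isCrystallizing
    (hex : ∀ n : ℕ, ∃ z : Fin n → E3, IsGroundState V z) {δ : ℝ} (hδ : 0 < δ)
    (hsepall : ∀ (N : ℕ) (x : Fin N → E3), IsGroundState V x →
      ∀ i j, i ≠ j → δ ≤ dist (x i) (x j))
    (h : IsCrystallizing V 3) :
    ∃ P : PeriodicConfiguration 3, IsLocalLimitOfGroundStates V 3 P.points := by
  classical
  set gs : (N : ℕ) → (Fin N → E3) := fun N => Classical.choose (hex N) with hgs
  have gs_isGroundState : ∀ N, IsGroundState V (gs N) := fun N => Classical.choose_spec (hex N)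
  obtain ⟨φ, τ, P, m, hφ, hm1, -, hlim⟩ := h gs gs_isGroundState
  refine ⟨P, gs, φ, τ, gs_isGroundState, hφ, fun R ε hε => ?_⟩
  set y : (j : ℕ) → Fin (φ j) → E3 := fun j i => gs (φ j) i + τ j with hy
  have hysep : ∀ j (i i' : Fin (φ j)), i ≠ i' → δ ≤ dist (y j i) (y j i') := fun j i i' hii' => by
    simp only [hy, dist_add_right]
    exact hsepall _ _ (gs_isGroundState _) i i' hii'
  obtain ⟨ρ, hρ, hPsep⟩ := P.exists_pos_le_dist
  -- (1) multiplicities are `1`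
  have hm_eq : ∀ s ∈ P.points, m s = 1 := by
    intro s hs
    refine le_antisymm ?_ (hm1 s hs)
    set r : ℝ := δ / 4 with hr
    have hrpos : 0 < r := by positivity
    have hl := hlim _ (coneBump.continuous s r) (coneBump.hasCompactSupport s r)
    have hbound : ∀ j, ∑ i, coneBump s r (y j i) ≤ r := by
      intro j
      by_cases hexi : ∃ i, 0 < coneBump s r (y j i)
      · obtain ⟨i₀, hi₀⟩ := hexi
        have hd₀ := coneBump.dist_lt_of_pos s r hi₀
        have hzero : ∀ i ∈ Finset.univ.erase i₀, coneBump s r (y j i) = 0 := by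
          intro i hi
          have hne : i ≠ i₀ := Finset.ne_of_mem_erase hi
          by_contra hne0
          have hpos : 0 < coneBump s r (y j i) :=
            lt_of_le_of_ne (coneBump.nonneg s r _) (Ne.symm hne0)
          have hd := coneBump.dist_lt_of_pos s r hpos
          have h1 := hysep j i i₀ hne
          have h2 : dist (y j i) (y j i₀) ≤ dist (y j i) s + dist (y j i₀) s :=
            dist_triangle_right _ _ _
          linarith
        rw [← Finset.add_sum_erase _ _ (Finset.mem_univ i₀), Finset.sum_eq_zero hzero, add_zero]
        exact coneBump_le s hrpos.le _
      · push Not at hexi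
        have : ∑ i, coneBump s r (y j i) ≤ 0 := Finset.sum_nonpos fun i _ => hexi i
        linarith
    have hge : (m s : ℝ) * r ≤ ∑' s' : P.points, (m s' : ℝ) * coneBump s r s' := by
      have := P.mul_le_tsum (coneBump.hasCompactSupport s r) (coneBump.nonneg s r) m hs
      rwa [coneBump.apply_self, max_eq_right hrpos.le] at this
    have hle : ∑' s' : P.points, (m s' : ℝ) * coneBump s r s' ≤ r :=
      le_of_tendsto' hl hbound
    have h1 : (m s : ℝ) * r ≤ 1 * r := by linarith
    exact_mod_cast le_of_mul_le_mul_right h1 hrpos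
  -- (2) every site eventually has a particle nearby
  have hnear : ∀ p ∈ P.points, ∀ ε' : ℝ, 0 < ε' → ∀ᶠ j in atTop, ∃ i, dist (y j i) p ≤ ε' := by
    intro p hp ε' hε'
    have hl := hlim _ (coneBump.continuous p ε') (coneBump.hasCompactSupport p ε')
    have hpos : (0 : ℝ) < ∑' s : P.points, (m s : ℝ) * coneBump p ε' s := by
      refine lt_of_lt_of_le ?_ (P.mul_le_tsum (coneBump.hasCompactSupport p ε')
        (coneBump.nonneg p ε') m hp)
      rw [coneBump.apply_self, max_eq_right hε'.le, hm_eq p hp]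
      simpa using hε'
    filter_upwards [hl.eventually (lt_mem_nhds hpos)] with j hj
    obtain ⟨i, -, hi⟩ := Finset.exists_lt_of_sum_lt
      (by simpa using hj : ∑ _i : Fin (φ j), (0 : ℝ) < ∑ i, coneBump p ε' (y j i))
    exact ⟨i, (coneBump.dist_lt_of_pos p ε' hi).le⟩
  -- (3) the finitely many sites in the balls of radii `R` and `R + 1`
  obtain ⟨T₁, hT₁⟩ := (P.finite_inter_points
    (isBounded_closedBall (x := (0 : E3)) (r := R))).exists_finset_coe
  obtain ⟨T₂, hT₂⟩ := (P.finite_inter_points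
    (isBounded_closedBall (x := (0 : E3)) (r := R + 1))).exists_finset_coe
  have hT₁mem : ∀ p, p ∈ T₁ ↔ ‖p‖ ≤ R ∧ p ∈ P.points := fun p => by
    rw [← Finset.mem_coe, hT₁, Set.mem_inter_iff, mem_closedBall_zero_iff]
  have hT₂mem : ∀ p, p ∈ T₂ ↔ ‖p‖ ≤ R + 1 ∧ p ∈ P.points := fun p => by
    rw [← Finset.mem_coe, hT₂, Set.mem_inter_iff, mem_closedBall_zero_iff]
  have hA : ∀ᶠ j in atTop, ∀ p ∈ T₁, ∃ i, dist (y j i) p ≤ ε :=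
    (Filter.eventually_all_finset T₁).2 fun p hp => hnear p ((hT₁mem p).1 hp).2 ε hε
  -- (4) the plateau test function `pl = min 1 (coneBump 0 (R+1))`
  set pl : E3 → ℝ := fun z => min 1 (coneBump 0 (R + 1) z) with hpl
  have hpl_cont : Continuous pl := continuous_const.min (coneBump.continuous 0 (R + 1))
  have hpl_nonneg : ∀ z, 0 ≤ pl z := fun z => le_min zero_le_one (coneBump.nonneg _ _ _)
  have hpl_support : Function.support pl ⊆ closedBall (0 : E3) (R + 1) := by
    intro z hz
    refine coneBump.support_subset 0 (R + 1) ?_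
    intro h0
    exact hz (by simp only [hpl, h0]; simp)
  have hpl_supp : HasCompactSupport pl :=
    HasCompactSupport.of_support_subset_isCompact (isCompact_closedBall 0 (R + 1)) hpl_support
  have hpl_tsupp : tsupport pl ⊆ closedBall (0 : E3) (R + 1) :=
    closure_minimal hpl_support isClosed_closedBall
  have hpl_one : ∀ z : E3, ‖z‖ ≤ R → pl z = 1 := fun z hz => by
    have : (1 : ℝ) ≤ coneBump 0 (R + 1) z := by
      refine le_trans ?_ (coneBump.sub_dist_le 0 (R + 1) z)
      rw [dist_zero_right]; linarith
    simp only [hpl]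
    exact min_eq_left this
  have hpl_lip : ∀ z s : E3, pl s - dist z s ≤ pl z := fun z s => by
    simp only [hpl]
    have h1 := coneBump_sub_dist_le_coneBump (0 : E3) (R + 1) z s
    have hd : 0 ≤ dist z s := dist_nonneg
    rcases le_total 1 (coneBump 0 (R + 1) z) with h | h
    · rw [min_eq_left h]
      linarith [min_le_left (1 : ℝ) (coneBump 0 (R + 1) s)]
    · rw [min_eq_right h]
      linarith [min_le_right (1 : ℝ) (coneBump 0 (R + 1) s)]
  -- its limit value
  set Λ₁ : ℝ := ∑ s ∈ T₂, pl s with hΛ₁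
  have hlimval : ∑' s : P.points, (m s : ℝ) * pl s = Λ₁ := by
    rw [P.tsum_mul_eq_sum hpl_tsupp m hT₂, hΛ₁]
    refine Finset.sum_congr rfl fun s hs => ?_
    rw [hm_eq s ((hT₂mem s).1 hs).2]
    simp
  have hC : ∀ᶠ j in atTop, ∑ i, pl (y j i) < Λ₁ + 1 / 2 := by
    have hl := hlim pl hpl_cont hpl_supp
    rw [hlimval] at hl
    exact hl.eventually (gt_mem_nhds (by linarith))
  -- the fine tolerance for the sites of `T₂`
  obtain ⟨ε'', hε'', hε''ε, hε''ρ, hε''c⟩ : ∃ ε'' : ℝ, 0 < ε'' ∧ ε'' ≤ ε ∧ 2 * ε'' < ρ ∧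
      (T₂.card : ℝ) * ε'' ≤ 1 / 4 := by
    refine ⟨min ε (min (ρ / 4) (1 / (4 * (T₂.card + 1)))), ?_, min_le_left _ _, ?_, ?_⟩
    · exact lt_min hε (lt_min (by positivity) (by positivity))
    · linarith [min_le_right ε (min (ρ / 4) (1 / (4 * (T₂.card + 1)))),
        min_le_left (ρ / 4) (1 / (4 * ((T₂.card : ℝ) + 1)))]
    · have h1 : min ε (min (ρ / 4) (1 / (4 * (T₂.card + 1)))) ≤ 1 / (4 * (T₂.card + 1)) :=
        (min_le_right _ _).trans (min_le_right _ _)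
      have h2 : (T₂.card : ℝ) * (1 / (4 * (T₂.card + 1))) ≤ 1 / 4 := by
        rw [mul_one_div, div_le_iff₀ (by positivity)]
        nlinarith [Nat.cast_nonneg (α := ℝ) T₂.card]
      exact (mul_le_mul_of_nonneg_left h1 (Nat.cast_nonneg _)).trans h2
  have hB : ∀ᶠ j in atTop, ∀ s ∈ T₂, ∃ i, dist (y j i) s ≤ ε'' :=
    (Filter.eventually_all_finset T₂).2 fun s hs => hnear s ((hT₂mem s).1 hs).2 ε'' hε''
  -- (5) conclusion
  filter_upwards [hA, hB, hC] with j hAj hBj hCj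
  refine ⟨fun p hp hpR => hAj p ((hT₁mem p).2 ⟨hpR, hp⟩), fun i hiR => ?_⟩
  by_contra hno
  push Not at hno
  haveI : Nonempty (Fin (φ j)) := ⟨i⟩
  choose! k hk using hBj
  have hkinj : Set.InjOn k ↑T₂ := by
    intro s hs s' hs' hss'
    by_contra hne
    have h1 := hPsep s ((hT₂mem s).1 hs).2 s' ((hT₂mem s').1 hs').2 hne
    have h2 : dist s s' ≤ dist (y j (k s)) s + dist (y j (k s')) s' := by
      rw [hss']; exact dist_triangle_left _ _ _
    linarith [hk s hs, hk s' hs']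
  have hki : i ∉ T₂.image k := by
    intro hmem
    obtain ⟨s, hs, hsk⟩ := Finset.mem_image.1 hmem
    have h1 := hk s hs
    rw [hsk] at h1
    have h2 := hno s ((hT₂mem s).1 hs).2
    linarith
  have hsub : ∑ i' ∈ insert i (T₂.image k), pl (y j i') ≤ ∑ i', pl (y j i') :=
    Finset.sum_le_sum_of_subset_of_nonneg (Finset.subset_univ _) fun i' _ _ => hpl_nonneg _
  rw [Finset.sum_insert hki, Finset.sum_image hkinj, hpl_one _ hiR] at hsub
  have hterms : ∑ s ∈ T₂, (pl s - ε'') ≤ ∑ s ∈ T₂, pl (y j (k s)) :=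
    Finset.sum_le_sum fun s hs => by linarith [hpl_lip (y j (k s)) s, hk s hs]
  rw [Finset.sum_sub_distrib, Finset.sum_const, nsmul_eq_mul] at hterms
  linarith

end Summit.AtomisticToContinuum.Crystallization.Theorems.MieRungEnergetic

end
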